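import Summits.QuantumFields.YangMills.Theorems.BalabanUVNodesN09StrictWindowMarginAtRecord

/-!
# NODE N09 [B12] — ROAD A′: THE (F1) TOWER'S TWO a.e.-CONTINUITY SOCKETS `hΦV hJV` — INTERIOR∕BOUNDARY BOOKKEEPING from window-interior openness of the
# one-variable (0.4) average, fibrewise continuity and non-vanishing of the inverse density, and the STRICT margin `(((d+2)L)²∕4)·ε₀ < α`

Cell `pub-ymgap` (YM-PLAN Track A), width seat `pub-ymgap-dag-n09-w5` g5 (D-0154 ∕ R399 (3a) width seat 5 of node N09), FILE 1b; helper of K1⁹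
`StabilityBRunRowsAtRecordR13SepCoPHV` = stmt-QuantumFields-27364 (`--supports`, `--as helper`, count-neutral).  [I] = [Balaban1987RG1] (CMP 109).

WHERE THIS SITS.  This seat's g4 tower `…N09TowerOfPerBondCharts.hreg_pos_all_of_perBondCharts_centralWindow` (p630630) turns N09's analytic inclusion `hreg_j` and (F3)_j
for all `j < K` into per-bond inversion data `(T, ϑ, jd)` of the one-variable (0.4) averages at the central `α`-windows plus FOUR displayed continuity sockets at road A′'s
re-based chart `Φ′ = A.piecewise Φ_tri (V^{(j)} ∘ fst)`, `J′ = A.indicator J_tri` (`A = {J_tri ≠ 0} ∩ Φ_tri⁻¹{χ^{(2.9)}_j ≠ 0}`): `hΦV hJV` (for every coarse `V₀` in the domain,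
for a.e. fine `z`, `V ↦ Φ′(V,z)` and `V ↦ J′(V,z)` are continuous within the domain at `V₀`) and `hΦc hJpos` (at the base point; dag-n09-w6 g4's INTENT-3).  dag-n09-w6 g4's
`…N09CentralWindowInverseContinuous` (p631266) proved the `ϑ`-half: EVERY left inverse on the windows is jointly continuous on the image graph, so `Φ_tri(·, z)` is
continuous on the coarse window set `W_z = {V | ∀ c, V c ∈ T_c(z)}` — and left «interior∕boundary bookkeeping and the `jd`-half» open.  THIS FILE does that bookkeeping:
`hΦV` and `hJV` at one level `j < K` are THEOREMS of
* (O-int) «the image window `T_c(U)` is a neighbourhood of `Ū′(c)(g)` for every `g` STRICTLY inside the central `α`-window of `U`» — local openness of the one-variable average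
  at interior window points (the inverse-function face; dag-n09-w4 g5's non-degeneracy `det_sliceDeriv_ne_zero_of_mem` is its natural supplier) — DISPLAYED;
* (C-jd) `jd_c(U, ·)` continuous on `T_c(U)` and (P) `jd_c(U, v) ≠ 0` on `T_c(U)` — DISPLAYED (the Jacobian's continuity ∕ non-vanishing, dag-n09-w4's currency);
* the image-window clause `hT` and the left-inverse clause `hleft` of dag-n09-w6 g3's `exists_perBondCharts_of_forwardLaws` (p627104), `α < δ_N`;
* the STRICT margin `(((d+2)L)²∕4)·θ₀.ν.ε₀ < α`, N07's `hcrit`, [B11]-existence `hsolν` and dag-n09-w4 g3's numerics (through `hχdom_of_hsolν_of_numerics`), `0 < ε₂₉`.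
THE MECHANISM.  Fix `V₀ ∈ domAlt_{j+1}` and a fine `z`.  (a) `V₀ ∉ W_z`: `W_z` is closed (compact image windows, p631266), so near `V₀` the chart is on its fallback branch
(`V^{(j)}`, continuous by `hcrit`; `J′ = 0`).  (b) `V₀ ∈ W_z` and some (2.9) deviation of `Φ_tri(V₀,z)` is `> ε₂₉`: by continuity of the deviations on `domAlt ∩ W_z`
(`Ū(Φ_tri(V,z)) = V` there, so the critical configuration is `V^{(j)}(V)`) the fallback branch persists near `V₀`.  (c) all deviations `< ε₂₉`: `χ^{(2.9)}_j(Φ_tri(V₀,z)) = 1`, so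
`Φ_tri(V₀,z) ∈ domAlt_j` (`hχdom`), its loop variables are `(((d+2)L)²∕4)·ε₀`-small, every private coordinate `ϑ_c(z, V₀ c)` lies STRICTLY inside `Ωα c z` (blindness
`centralWindow_extend` + the strict margin), so by (O-int) every `T_c(z)` is a neighbourhood of `V₀ c`, `W_z ∈ 𝓝 V₀`, and near `V₀` the chart is on its `Φ_tri` branch — continuous
by p631266 and (C-jd).  (d) some deviation `= ε₂₉` exactly, with `V₀ ∈ W_z`: this is dag-n09-w3 g5's null set `fieldMeasure_thresholdSet_extendCentralBond_eq_zero` (p625076).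

WHAT IS PROVED (theorems only; 0 def, 0 instance, 0 notation, 0 sorry; the one-bond ∕ fixed-environment ∕ margin tools are FILE 1a `…N09StrictWindowMarginAtRecord`).
★★ `continuousWithinAt_towerChart_of_not_threshold` (deterministic core at `(V₀, z)` off the exact thresholds) · `ae_not_threshold` (dag-n09-w3 g5's nullity, all bonds at once) ·
★★★ `tower_hΦV_of_windowOpenness_of_hsolν_of_numerics` · ★★★ `tower_hJV_of_windowOpenness_of_hsolν_of_numerics` (the two socket SHAPES of p630630 VERBATIM at one level `j < K`).

HONEST FRAMING.  LOCATED, count-neutral classical topology ∕ measure-zero bookkeeping BY NAME on the tree's typed (0.4) objects; (O-int), (C-jd), (P), `hT`∕`hleft`, `hcrit`,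
`hsolν` and the numerics are DISPLAYED hypotheses, asserted of NO record; NO Jacobian law, NO openness, NO continuity of a density proved; nothing of Bałaban's estimates
asserted; `hΦc hJpos` untouched (dag-n09-w6's); `hreg` NOT discharged; N09 NOT discharged; conjunct 1 (Lemma 4) ∕ FLAG №7 untouched; K0⁷ ∕ K1⁹ ∕ K3⁸ NOT closed; counts
unmoved (typed 28∕28 · discharged 5∕28); no summit statement is proved by this seat; one finite four-torus programme at fixed `ε = L^{−K}` per run — R4 closes the conditional
rung `BalabanLadder.UV` only; NOT continuum ∕ ℝ⁴ ∕ infinite volume ∕ OS; the Yang–Mills mass gap (Clay) is NOT proved by any of this.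
-/

noncomputable section

namespace Summit.QuantumFields.YangMills.BalabanUVNodes.N09TowerAESocketsOfWindowOpenness

open MeasureTheory Set Function Filter Topology
open scoped ENNReal NNReal
open Literature.MathematicalPhysics.QuantumFieldTheory.Balaban1983to89
open Literature.MathematicalPhysics.QuantumFieldTheory.Balaban1983to89.T4Continuum (T4Family)
open Literature.MathematicalPhysics.QuantumFieldTheory.Balaban1983to89.Node00
open Literature.MathematicalPhysics.QuantumFieldTheory.Balaban1983to89.ExpMeanLog (deltaSU)
open Literature.MathematicalPhysics.QuantumFieldTheory.Balaban1983to89.BlockAveraging (Idx)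
open Literature.MathematicalPhysics.QuantumFieldTheory.Balaban1983to89.BlockAveragingHaarAC (centralBond pre post)
open Literature.MathematicalPhysics.QuantumFieldTheory.Balaban1983to89.BlockAveragingEMLHaarAC (fibreFamily)
open N09CentralWindowInverseContinuous (isCompact_imageWindow_record)
open N09FibreThresholdNullOfCharts (fieldMeasure_thresholdSet_extendCentralBond_eq_zero)
open N09StrictWindowMarginAtRecord

variable {F : T4Family} {N : ℕ} [NeZero N] {K j : ℕ}

/-! ## §1  The sockets (tools: FILE 1a) -/

section Sockets

variable (θ₀ : Stage13Params F N) (g : ℕ → ℝ) {α : ℝ}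
  (T : PBond (F.P K) (j + 1) → GaugeField (F.P K) j (SU N) → Set (SU N)) (ϑ : PBond (F.P K) (j + 1) → GaugeField (F.P K) j (SU N) → SU N → SU N)
  (jd : PBond (F.P K) (j + 1) → GaugeField (F.P K) j (SU N) → SU N → ℝ≥0)

/-- ★★ **DETERMINISTIC CORE: OFF THE EXACT THRESHOLDS, BOTH RE-BASED OBJECTS ARE CONTINUOUS IN THE COARSE FIELD.**  At `(V₀, z)` with `V₀ ∈ domAlt_{j+1}` and NO exact
threshold event «`V₀ ∈ W_z` and `fluctDev_j(Φ_tri(V₀,z))(b) = ε₂₉` for some `¬IsB0 b`»: `V ↦ Φ′(V,z) = A.piecewise Φ_tri (V^{(j)} ∘ fst) (V,z)` and `V ↦ (J′(V,z) : ℝ)`,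
`J′ = A.indicator J_tri`, are continuous within `domAlt_{j+1}` at `V₀` — cases (a) `V₀ ∉ W_z`, (b) a deviation `> ε₂₉`, (c) all `< ε₂₉` of the module docstring.
CONDITIONAL on (O-int), (C-jd), (P), `hT`, `hleft`, `α < δ_N`, the strict margin, `hcrit`, `hsolν`, numerics — all displayed.
[cite: Balaban1987RG1, (0.4) p.253, p.259, (2.3) p.265, (2.9)–(2.10) pp.266–267; Balaban1985Averaging, Prop. 2 (53) p.26; Balaban1985Variational, Thm 1 (8)–(10) p.279] -/
theorem continuousWithinAt_towerChart_of_not_threshold (hj : j < K) (hαδ : α < deltaSU (Fin N))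
    (hT : ∀ c U, T c U = (fun g => (avOfRecord F N K j).avg (update U (centralBond c) g) c) ''
        {g : SU N | ∀ i : Idx (F.P K), dist1 (fibreFamily U c (pre U c * g * post U c) i) ≤ α})
    (hleft : ∀ c U g, (∀ i : Idx (F.P K), dist1 (fibreFamily U c (pre U c * g * post U c) i) ≤ α) →
        ϑ c U ((avOfRecord F N K j).avg (update U (centralBond c) g) c) = g)
    (hopen : ∀ (c : PBond (F.P K) (j + 1)) (U : GaugeField (F.P K) j (SU N)) (g : SU N),
      (∀ i : Idx (F.P K), dist1 (fibreFamily U c (pre U c * g * post U c) i) < α) →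
        (fun g' => (avOfRecord F N K j).avg (update U (centralBond c) g') c) ''
            {g' : SU N | ∀ i : Idx (F.P K), dist1 (fibreFamily U c (pre U c * g' * post U c) i) ≤ α} ∈
          𝓝 ((avOfRecord F N K j).avg (update U (centralBond c) g) c))
    (hjc : ∀ c U, ContinuousOn (jd c U) (T c U)) (hjd0 : ∀ c U v, v ∈ T c U → jd c U v ≠ 0)
    (hεreg : 0 < θ₀.ν.εreg) (hε3 : (143 * (((((F.P K).d + 4 : ℕ) : ℝ)) ^ 2 / 4) ^ 2) * θ₀.ν.εreg ≤ 1 / 3)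
    (hε2 : 2 * θ₀.ν.εreg ≤ 2 * deltaSU (Fin N) / ((((F.P K).d + 4) * (F.P K).L : ℕ) : ℝ) ^ 2) (hε29 : 0 ≤ θ₀.ε₂₉)
    (hn1 : 1640 * (2 * (((((F.P K).d + 2) * (F.P K).L : ℕ) : ℝ) * θ₀.ε₂₉) +
        ((((F.P K).d + 2) * (F.P K).L : ℕ) : ℝ) ^ 2 / 4 * (2 * θ₀.ν.εreg / ((F.P K).L : ℝ) ^ 2)) * (((F.P K).L : ℝ) ^ ((F.P K).d - 1)) ^ 2 ≤ 1)
    (hn2 : 13 * (2 * (((((F.P K).d + 2) * (F.P K).L : ℕ) : ℝ) * θ₀.ε₂₉) +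
        ((((F.P K).d + 2) * (F.P K).L : ℕ) : ℝ) ^ 2 / 4 * (2 * θ₀.ν.εreg / ((F.P K).L : ℝ) ^ 2)) * ((F.P K).L : ℝ) ^ ((F.P K).d - 1) < deltaSU (Fin N))
    (hord : 2 * θ₀.ν.εreg / ((F.P K).L : ℝ) ^ 2 +
      4 * max θ₀.ε₂₉ (10 * (((((F.P K).d + 2) * (F.P K).L : ℕ) : ℝ) * θ₀.ε₂₉) * ((F.P K).L : ℝ) ^ ((F.P K).d - 1)) ≤ θ₀.ν.ε₀)
    (hsolν : ∀ j < K, ∀ W ∈ domAltOfRecord F N θ₀.ν K (j + 1), UkExists F N K (j + 1) θ₀.ν.εreg W)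
    (hα : ((((F.P K).d + 2) * (F.P K).L : ℕ) : ℝ) ^ 2 / 4 * θ₀.ν.ε₀ < α)
    (hcrit : ContinuousOn (critCfgOfRecord F N θ₀.ν K j) (domAltOfRecord F N θ₀.ν K (j + 1)))
    [DecidablePred (· ∈ {p : ((PBond (F.P K) (j + 1) → SU N) × GaugeField (F.P K) j (SU N)) |
          ({q : ((PBond (F.P K) (j + 1) → SU N) × GaugeField (F.P K) j (SU N)) | ∀ c, q.1 c ∈ T c q.2}.indicator fun q => ∏ c, jd c q.2 (q.1 c)) p ≠ 0 ∧
            (extend centralBond (fun c => ϑ c p.2 (p.1 c)) p.2 : GaugeField (F.P K) j (SU N)) ∈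
              {U : GaugeField (F.P K) j (SU N) | chiFixed29 F N θ₀.ν θ₀.ε₂₉ K g j U ≠ 0}})]
    {V₀ : PBond (F.P K) (j + 1) → SU N} (hV₀ : V₀ ∈ domAltOfRecord F N θ₀.ν K (j + 1)) {z : GaugeField (F.P K) j (SU N)}
    (hz : ∀ b : PBond (F.P K) j, ¬ IsB0 b →
      ¬ ((∀ c, V₀ c ∈ T c z) ∧ fluctDevOfRecord F N θ₀.ν K j (extend centralBond (fun c => ϑ c z (V₀ c)) z) b = θ₀.ε₂₉)) :
    ContinuousWithinAt (fun V => (Set.piecewise {p : ((PBond (F.P K) (j + 1) → SU N) × GaugeField (F.P K) j (SU N)) |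
          ({q : ((PBond (F.P K) (j + 1) → SU N) × GaugeField (F.P K) j (SU N)) | ∀ c, q.1 c ∈ T c q.2}.indicator fun q => ∏ c, jd c q.2 (q.1 c)) p ≠ 0 ∧
            (extend centralBond (fun c => ϑ c p.2 (p.1 c)) p.2 : GaugeField (F.P K) j (SU N)) ∈
              {U : GaugeField (F.P K) j (SU N) | chiFixed29 F N θ₀.ν θ₀.ε₂₉ K g j U ≠ 0}}
        (fun p => (extend centralBond (fun c => ϑ c p.2 (p.1 c)) p.2 : GaugeField (F.P K) j (SU N)))
        (fun p => critCfgOfRecord F N θ₀.ν K j p.1)) (V, z)) (domAltOfRecord F N θ₀.ν K (j + 1)) V₀ ∧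
      ContinuousWithinAt (fun V => (((Set.indicator {p : ((PBond (F.P K) (j + 1) → SU N) × GaugeField (F.P K) j (SU N)) |
          ({q : ((PBond (F.P K) (j + 1) → SU N) × GaugeField (F.P K) j (SU N)) | ∀ c, q.1 c ∈ T c q.2}.indicator fun q => ∏ c, jd c q.2 (q.1 c)) p ≠ 0 ∧
            (extend centralBond (fun c => ϑ c p.2 (p.1 c)) p.2 : GaugeField (F.P K) j (SU N)) ∈
              {U : GaugeField (F.P K) j (SU N) | chiFixed29 F N θ₀.ν θ₀.ε₂₉ K g j U ≠ 0}}
        ({q : ((PBond (F.P K) (j + 1) → SU N) × GaugeField (F.P K) j (SU N)) | ∀ c, q.1 c ∈ T c q.2}.indicator fun q => ∏ c, jd c q.2 (q.1 c))) (V, z) : ℝ≥0) : ℝ))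
        (domAltOfRecord F N θ₀.ν K (j + 1)) V₀ := by
  -- bookkeeping on the rebase set `A` at the slice `z`
  have hnotW : ∀ V : PBond (F.P K) (j + 1) → SU N, ¬ (∀ c, V c ∈ T c z) →
      (V, z) ∉ {p : ((PBond (F.P K) (j + 1) → SU N) × GaugeField (F.P K) j (SU N)) |
          ({q : ((PBond (F.P K) (j + 1) → SU N) × GaugeField (F.P K) j (SU N)) | ∀ c, q.1 c ∈ T c q.2}.indicator fun q => ∏ c, jd c q.2 (q.1 c)) p ≠ 0 ∧
            (extend centralBond (fun c => ϑ c p.2 (p.1 c)) p.2 : GaugeField (F.P K) j (SU N)) ∈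
              {U : GaugeField (F.P K) j (SU N) | chiFixed29 F N θ₀.ν θ₀.ε₂₉ K g j U ≠ 0}} := by
    intro V hV hA
    exact hA.1 (indicator_of_notMem (show (V, z) ∉ {q : ((PBond (F.P K) (j + 1) → SU N) × GaugeField (F.P K) j (SU N)) | ∀ c, q.1 c ∈ T c q.2} from hV) _)
  have hnotχ : ∀ V : PBond (F.P K) (j + 1) → SU N, chiFixed29 F N θ₀.ν θ₀.ε₂₉ K g j (extend centralBond (fun c => ϑ c z (V c)) z) = 0 →
      (V, z) ∉ {p : ((PBond (F.P K) (j + 1) → SU N) × GaugeField (F.P K) j (SU N)) |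
          ({q : ((PBond (F.P K) (j + 1) → SU N) × GaugeField (F.P K) j (SU N)) | ∀ c, q.1 c ∈ T c q.2}.indicator fun q => ∏ c, jd c q.2 (q.1 c)) p ≠ 0 ∧
            (extend centralBond (fun c => ϑ c p.2 (p.1 c)) p.2 : GaugeField (F.P K) j (SU N)) ∈
              {U : GaugeField (F.P K) j (SU N) | chiFixed29 F N θ₀.ν θ₀.ε₂₉ K g j U ≠ 0}} := fun V hV hA => hA.2 hV
  have hmemA : ∀ V : PBond (F.P K) (j + 1) → SU N, (∀ c, V c ∈ T c z) → chiFixed29 F N θ₀.ν θ₀.ε₂₉ K g j (extend centralBond (fun c => ϑ c z (V c)) z) ≠ 0 →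
      (V, z) ∈ {p : ((PBond (F.P K) (j + 1) → SU N) × GaugeField (F.P K) j (SU N)) |
          ({q : ((PBond (F.P K) (j + 1) → SU N) × GaugeField (F.P K) j (SU N)) | ∀ c, q.1 c ∈ T c q.2}.indicator fun q => ∏ c, jd c q.2 (q.1 c)) p ≠ 0 ∧
            (extend centralBond (fun c => ϑ c p.2 (p.1 c)) p.2 : GaugeField (F.P K) j (SU N)) ∈
              {U : GaugeField (F.P K) j (SU N) | chiFixed29 F N θ₀.ν θ₀.ε₂₉ K g j U ≠ 0}} := by
    intro V hV hχ
    refine ⟨?_, hχ⟩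
    rw [indicator_of_mem (show (V, z) ∈ {q : ((PBond (F.P K) (j + 1) → SU N) × GaugeField (F.P K) j (SU N)) | ∀ c, q.1 c ∈ T c q.2} from hV)]
    exact Finset.prod_ne_zero_iff.2 fun c _ => hjd0 c z (V c) (hV c)
  -- the (2.9) cut-off along the chart, unfolded
  have hχiff : ∀ V : PBond (F.P K) (j + 1) → SU N, chiFixed29 F N θ₀.ν θ₀.ε₂₉ K g j (extend centralBond (fun c => ϑ c z (V c)) z) ≠ 0 ↔
      ∀ b : PBond (F.P K) j, ¬ IsB0 b → fluctDevOfRecord F N θ₀.ν K j (extend centralBond (fun c => ϑ c z (V c)) z) b < θ₀.ε₂₉ := by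
    intro V
    rw [chiFixed29_apply, ← chiFix29OfRecord_eq_one_iff]
    rcases chiFix29OfRecord_eq_zero_or_one θ₀.ν θ₀.ε₂₉ K j (extend centralBond (fun c => ϑ c z (V c)) z : GaugeField (F.P K) j (SU N)) with h | h
    · rw [h]; simp
    · rw [h]; simp
  -- the FALLBACK conclusion: if eventually (within the domain) and at `V₀` the point is off `A`, both objects are continuous at `V₀`
  have hfallback : (∀ᶠ V in 𝓝[domAltOfRecord F N θ₀.ν K (j + 1)] V₀,
      (V, z) ∉ {p : ((PBond (F.P K) (j + 1) → SU N) × GaugeField (F.P K) j (SU N)) |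
          ({q : ((PBond (F.P K) (j + 1) → SU N) × GaugeField (F.P K) j (SU N)) | ∀ c, q.1 c ∈ T c q.2}.indicator fun q => ∏ c, jd c q.2 (q.1 c)) p ≠ 0 ∧
            (extend centralBond (fun c => ϑ c p.2 (p.1 c)) p.2 : GaugeField (F.P K) j (SU N)) ∈
              {U : GaugeField (F.P K) j (SU N) | chiFixed29 F N θ₀.ν θ₀.ε₂₉ K g j U ≠ 0}}) →
      (V₀, z) ∉ {p : ((PBond (F.P K) (j + 1) → SU N) × GaugeField (F.P K) j (SU N)) |
          ({q : ((PBond (F.P K) (j + 1) → SU N) × GaugeField (F.P K) j (SU N)) | ∀ c, q.1 c ∈ T c q.2}.indicator fun q => ∏ c, jd c q.2 (q.1 c)) p ≠ 0 ∧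
            (extend centralBond (fun c => ϑ c p.2 (p.1 c)) p.2 : GaugeField (F.P K) j (SU N)) ∈
              {U : GaugeField (F.P K) j (SU N) | chiFixed29 F N θ₀.ν θ₀.ε₂₉ K g j U ≠ 0}} →
      ContinuousWithinAt (fun V => (Set.piecewise {p : ((PBond (F.P K) (j + 1) → SU N) × GaugeField (F.P K) j (SU N)) |
          ({q : ((PBond (F.P K) (j + 1) → SU N) × GaugeField (F.P K) j (SU N)) | ∀ c, q.1 c ∈ T c q.2}.indicator fun q => ∏ c, jd c q.2 (q.1 c)) p ≠ 0 ∧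
            (extend centralBond (fun c => ϑ c p.2 (p.1 c)) p.2 : GaugeField (F.P K) j (SU N)) ∈
              {U : GaugeField (F.P K) j (SU N) | chiFixed29 F N θ₀.ν θ₀.ε₂₉ K g j U ≠ 0}}
        (fun p => (extend centralBond (fun c => ϑ c p.2 (p.1 c)) p.2 : GaugeField (F.P K) j (SU N)))
        (fun p => critCfgOfRecord F N θ₀.ν K j p.1)) (V, z)) (domAltOfRecord F N θ₀.ν K (j + 1)) V₀ ∧
      ContinuousWithinAt (fun V => (((Set.indicator {p : ((PBond (F.P K) (j + 1) → SU N) × GaugeField (F.P K) j (SU N)) |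
          ({q : ((PBond (F.P K) (j + 1) → SU N) × GaugeField (F.P K) j (SU N)) | ∀ c, q.1 c ∈ T c q.2}.indicator fun q => ∏ c, jd c q.2 (q.1 c)) p ≠ 0 ∧
            (extend centralBond (fun c => ϑ c p.2 (p.1 c)) p.2 : GaugeField (F.P K) j (SU N)) ∈
              {U : GaugeField (F.P K) j (SU N) | chiFixed29 F N θ₀.ν θ₀.ε₂₉ K g j U ≠ 0}}
        ({q : ((PBond (F.P K) (j + 1) → SU N) × GaugeField (F.P K) j (SU N)) | ∀ c, q.1 c ∈ T c q.2}.indicator fun q => ∏ c, jd c q.2 (q.1 c))) (V, z) : ℝ≥0) : ℝ))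
        (domAltOfRecord F N θ₀.ν K (j + 1)) V₀ := by
    intro hev h0
    refine ⟨(hcrit V₀ hV₀).congr_of_eventuallyEq ?_ ?_, (continuousWithinAt_const (b := (0 : ℝ))).congr_of_eventuallyEq ?_ ?_⟩
    · exact hev.mono fun V hV => piecewise_eq_of_notMem _ _ _ hV
    · exact piecewise_eq_of_notMem _ _ _ h0
    · refine hev.mono fun V hV => ?_
      show ((Set.indicator _ _ (V, z) : ℝ≥0) : ℝ) = 0
      rw [indicator_of_notMem hV, NNReal.coe_zero]
    · show ((Set.indicator _ _ (V₀, z) : ℝ≥0) : ℝ) = 0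
      rw [indicator_of_notMem h0, NNReal.coe_zero]
  by_cases hW : ∀ c, V₀ c ∈ T c z
  swap
  · -- (a) `V₀ ∉ W_z`: `W_z` is closed, so near `V₀` the fallback branch is active
    obtain ⟨c₀, hc₀⟩ := not_forall.1 hW
    have hev : ∀ᶠ V in 𝓝 V₀, V c₀ ∉ T c₀ z :=
      (continuous_apply c₀).continuousAt.preimage_mem_nhds (((isCompact_imageWindow_record hj hαδ T hT c₀ z).isClosed).isOpen_compl.mem_nhds hc₀)
    exact hfallback (by
      filter_upwards [mem_nhdsWithin_of_mem_nhds hev] with V hV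
      exact hnotW V fun h => hV (h c₀)) (hnotW V₀ hW)
  -- `V₀ ∈ W_z`: continuity of the deviations within `domAlt ∩ W_z`
  have hcontb : ∀ b : PBond (F.P K) j, ContinuousWithinAt
      (fun V : PBond (F.P K) (j + 1) → SU N => fluctDevOfRecord F N θ₀.ν K j (extend centralBond (fun c => ϑ c z (V c)) z) b)
      (domAltOfRecord F N θ₀.ν K (j + 1) ∩ {V : PBond (F.P K) (j + 1) → SU N | ∀ c, V c ∈ T c z}) V₀ :=
    fun b => continuousOn_fluctDev_triChart_coarse θ₀.ν hj hαδ T ϑ hT hleft hcrit z b V₀ ⟨hV₀, hW⟩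
  by_cases hlt : ∀ b : PBond (F.P K) j, ¬ IsB0 b → fluctDevOfRecord F N θ₀.ν K j (extend centralBond (fun c => ϑ c z (V₀ c)) z) b < θ₀.ε₂₉
  swap
  · -- (b) some deviation is `≥ ε₂₉`, hence `> ε₂₉` (no exact threshold at `(V₀, z)`): the fallback branch persists near `V₀`
    obtain ⟨b, hb⟩ := not_forall.1 hlt
    obtain ⟨hb0, hge⟩ := Classical.not_imp.1 hb
    have hgt : θ₀.ε₂₉ < fluctDevOfRecord F N θ₀.ν K j (extend centralBond (fun c => ϑ c z (V₀ c)) z) b :=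
      lt_of_le_of_ne (not_lt.1 hge) fun h => hz b hb0 ⟨hW, h.symm⟩
    have hev : ∀ᶠ V in 𝓝[domAltOfRecord F N θ₀.ν K (j + 1) ∩ {V : PBond (F.P K) (j + 1) → SU N | ∀ c, V c ∈ T c z}] V₀,
        θ₀.ε₂₉ < fluctDevOfRecord F N θ₀.ν K j (extend centralBond (fun c => ϑ c z (V c)) z) b :=
      (hcontb b).eventually (Ioi_mem_nhds hgt)
    rw [nhdsWithin_inter', eventually_inf_principal] at hev
    refine hfallback ?_ (hnotχ V₀ (not_ne_iff.1 fun h => (not_lt.2 ((hχiff V₀).1 h b hb0).le) hgt))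
    filter_upwards [hev] with V hV
    by_cases hVW : ∀ c, V c ∈ T c z
    · exact hnotχ V (not_ne_iff.1 fun h => (not_lt.2 ((hχiff V).1 h b hb0).le) (hV hVW))
    · exact hnotW V hVW
  -- (c) all deviations `< ε₂₉`: the chart branch is active near `V₀`, and `W_z ∈ 𝓝 V₀` by the margin and (O-int)
  have hχ0 : chiFixed29 F N θ₀.ν θ₀.ε₂₉ K g j (extend centralBond (fun c => ϑ c z (V₀ c)) z) ≠ 0 := (hχiff V₀).2 hlt
  have hWn : {V : PBond (F.P K) (j + 1) → SU N | ∀ c, V c ∈ T c z} ∈ 𝓝 V₀ :=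
    coarseWindow_mem_nhds_of_chi_ne_zero θ₀ g hj T ϑ hT hleft hopen hεreg hε3 hε2 hε29 hn1 hn2 hord hsolν hα hV₀ hW hχ0
  have hnhds : 𝓝[domAltOfRecord F N θ₀.ν K (j + 1) ∩ {V : PBond (F.P K) (j + 1) → SU N | ∀ c, V c ∈ T c z}] V₀ = 𝓝[domAltOfRecord F N θ₀.ν K (j + 1)] V₀ :=
    nhdsWithin_inter_of_mem' (mem_nhdsWithin_of_mem_nhds hWn)
  have hevA : ∀ᶠ V in 𝓝[domAltOfRecord F N θ₀.ν K (j + 1)] V₀,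
      (V, z) ∈ {p : ((PBond (F.P K) (j + 1) → SU N) × GaugeField (F.P K) j (SU N)) |
          ({q : ((PBond (F.P K) (j + 1) → SU N) × GaugeField (F.P K) j (SU N)) | ∀ c, q.1 c ∈ T c q.2}.indicator fun q => ∏ c, jd c q.2 (q.1 c)) p ≠ 0 ∧
            (extend centralBond (fun c => ϑ c p.2 (p.1 c)) p.2 : GaugeField (F.P K) j (SU N)) ∈
              {U : GaugeField (F.P K) j (SU N) | chiFixed29 F N θ₀.ν θ₀.ε₂₉ K g j U ≠ 0}} := by
    have hev : ∀ᶠ V in 𝓝[domAltOfRecord F N θ₀.ν K (j + 1) ∩ {V : PBond (F.P K) (j + 1) → SU N | ∀ c, V c ∈ T c z}] V₀,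
        ∀ b : PBond (F.P K) j, ¬ IsB0 b → fluctDevOfRecord F N θ₀.ν K j (extend centralBond (fun c => ϑ c z (V c)) z) b < θ₀.ε₂₉ := by
      refine eventually_all.2 fun b => ?_
      by_cases hb0 : IsB0 b
      · exact Eventually.of_forall fun V h => (h hb0).elim
      · exact ((hcontb b).eventually (Iio_mem_nhds (hlt b hb0))).mono fun V hV _ => hV
    have hev' : ∀ᶠ V in 𝓝[domAltOfRecord F N θ₀.ν K (j + 1) ∩ {V : PBond (F.P K) (j + 1) → SU N | ∀ c, V c ∈ T c z}] V₀, ∀ c, V c ∈ T c z :=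
      eventually_mem_nhdsWithin.mono fun V hV => hV.2
    rw [← hnhds]
    exact (hev.and hev').mono fun V hV => hmemA V hV.2 ((hχiff V).2 hV.1)
  have hA0 := hmemA V₀ hW hχ0
  have hΦat : ContinuousAt (fun V : PBond (F.P K) (j + 1) → SU N => (extend centralBond (fun c => ϑ c z (V c)) z : GaugeField (F.P K) j (SU N))) V₀ :=
    (continuousOn_triChart_coarse hj hαδ T ϑ hT hleft z).continuousAt hWn
  have hJat : ContinuousAt (fun V : PBond (F.P K) (j + 1) → SU N => ((∏ c, jd c z (V c) : ℝ≥0) : ℝ)) V₀ :=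
    NNReal.continuous_coe.continuousAt.comp ((continuousOn_triJacobian_coarse T jd hjc z).continuousAt hWn)
  have hevW : ∀ᶠ V in 𝓝[domAltOfRecord F N θ₀.ν K (j + 1)] V₀, V ∈ {V : PBond (F.P K) (j + 1) → SU N | ∀ c, V c ∈ T c z} :=
    eventually_mem_set.2 (mem_nhdsWithin_of_mem_nhds hWn)
  refine ⟨hΦat.continuousWithinAt.congr_of_eventuallyEq (hevA.mono fun V hV => piecewise_eq_of_mem _ _ _ hV) (piecewise_eq_of_mem _ _ _ hA0),
    hJat.continuousWithinAt.congr_of_eventuallyEq ?_ ?_⟩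
  · refine (hevA.and hevW).mono fun V hV => ?_
    show (((Set.indicator _ _ (V, z) : ℝ≥0)) : ℝ) = ((∏ c, jd c z (V c) : ℝ≥0) : ℝ)
    rw [indicator_of_mem hV.1, indicator_of_mem (show (V, z) ∈ {q : ((PBond (F.P K) (j + 1) → SU N) × GaugeField (F.P K) j (SU N)) | ∀ c, q.1 c ∈ T c q.2} from hV.2)]
  · show (((Set.indicator _ _ (V₀, z) : ℝ≥0)) : ℝ) = ((∏ c, jd c z (V₀ c) : ℝ≥0) : ℝ)
    rw [indicator_of_mem hA0, indicator_of_mem (show (V₀, z) ∈ {q : ((PBond (F.P K) (j + 1) → SU N) × GaugeField (F.P K) j (SU N)) | ∀ c, q.1 c ∈ T c q.2} from hW)]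

/-- **The exact-threshold events are null, all non-distinguished bonds at once** (finite union of dag-n09-w3 g5's null sets `fieldMeasure_thresholdSet_extendCentralBond_eq_zero`;
`0 < ε₂₉`; the right-inverse property from `hT` + `hleft`). [cite: Balaban1987RG1, (2.9) p.266 and (2.10) p.267; Balaban1985Averaging, (19) p.21] -/
theorem ae_not_threshold (hj : j < K)
    (hT : ∀ c U, T c U = (fun g => (avOfRecord F N K j).avg (update U (centralBond c) g) c) ''
        {g : SU N | ∀ i : Idx (F.P K), dist1 (fibreFamily U c (pre U c * g * post U c) i) ≤ α})
    (hleft : ∀ c U g, (∀ i : Idx (F.P K), dist1 (fibreFamily U c (pre U c * g * post U c) i) ≤ α) →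
        ϑ c U ((avOfRecord F N K j).avg (update U (centralBond c) g) c) = g)
    (hε29 : 0 < θ₀.ε₂₉) (V₀ : PBond (F.P K) (j + 1) → SU N) :
    ∀ᵐ z ∂(fieldMeasure (F.P K) j (SU N)), ∀ b : PBond (F.P K) j, ¬ IsB0 b →
      ¬ ((∀ c, V₀ c ∈ T c z) ∧ fluctDevOfRecord F N θ₀.ν K j (extend centralBond (fun c => ϑ c z (V₀ c)) z) b = θ₀.ε₂₉) := by
  refine ae_all_iff.2 fun b => ?_
  by_cases hb : IsB0 b
  · exact Eventually.of_forall fun z h => (h hb).elim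
  · have h0 := fieldMeasure_thresholdSet_extendCentralBond_eq_zero θ₀.ν hj T ϑ (rightInverse_of_imageWindow_of_leftInverse T ϑ hT hleft) V₀ hb hε29.ne'
    rw [measure_eq_zero_iff_ae_notMem] at h0
    filter_upwards [h0] with z hz
    exact fun _ => hz

/-- ★★★ **THE TOWER'S SOCKET `hΦV` AT LEVEL `j < K`** — the SHAPE of `…N09TowerOfPerBondCharts.hreg_pos_all_of_perBondCharts_centralWindow`'s binder `hΦV j hj` VERBATIM: for every
`V₀ ∈ domAlt_{j+1}`, for `fieldMeasure`-a.e. fine field `z`, the re-based chart `V ↦ Φ′(V, z)` is continuous within `domAlt_{j+1}` at `V₀`.  From (O-int), (C-jd), (P), `hT`,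
`hleft`, `α < δ_N`, the STRICT margin, `hcrit`, `hsolν`, numerics, `0 < ε₂₉` — all DISPLAYED; the exceptional set is dag-n09-w3 g5's.  Nothing of Bałaban's asserted.
[cite: Balaban1987RG1, (0.4) p.253, p.259, (2.3) p.265, (2.9)–(2.10) pp.266–267; Balaban1985Averaging, (19) p.21 and Prop. 2 (53) p.26; Balaban1985Variational, Thm 1 (8)–(10) p.279] -/
theorem tower_hΦV_of_windowOpenness_of_hsolν_of_numerics (hj : j < K) (hαδ : α < deltaSU (Fin N))
    (hT : ∀ c U, T c U = (fun g => (avOfRecord F N K j).avg (update U (centralBond c) g) c) ''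
        {g : SU N | ∀ i : Idx (F.P K), dist1 (fibreFamily U c (pre U c * g * post U c) i) ≤ α})
    (hleft : ∀ c U g, (∀ i : Idx (F.P K), dist1 (fibreFamily U c (pre U c * g * post U c) i) ≤ α) →
        ϑ c U ((avOfRecord F N K j).avg (update U (centralBond c) g) c) = g)
    (hopen : ∀ (c : PBond (F.P K) (j + 1)) (U : GaugeField (F.P K) j (SU N)) (g : SU N),
      (∀ i : Idx (F.P K), dist1 (fibreFamily U c (pre U c * g * post U c) i) < α) →
        (fun g' => (avOfRecord F N K j).avg (update U (centralBond c) g') c) ''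
            {g' : SU N | ∀ i : Idx (F.P K), dist1 (fibreFamily U c (pre U c * g' * post U c) i) ≤ α} ∈
          𝓝 ((avOfRecord F N K j).avg (update U (centralBond c) g) c))
    (hjc : ∀ c U, ContinuousOn (jd c U) (T c U)) (hjd0 : ∀ c U v, v ∈ T c U → jd c U v ≠ 0)
    (hεreg : 0 < θ₀.ν.εreg) (hε3 : (143 * (((((F.P K).d + 4 : ℕ) : ℝ)) ^ 2 / 4) ^ 2) * θ₀.ν.εreg ≤ 1 / 3)
    (hε2 : 2 * θ₀.ν.εreg ≤ 2 * deltaSU (Fin N) / ((((F.P K).d + 4) * (F.P K).L : ℕ) : ℝ) ^ 2) (hε29 : 0 < θ₀.ε₂₉)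
    (hn1 : 1640 * (2 * (((((F.P K).d + 2) * (F.P K).L : ℕ) : ℝ) * θ₀.ε₂₉) +
        ((((F.P K).d + 2) * (F.P K).L : ℕ) : ℝ) ^ 2 / 4 * (2 * θ₀.ν.εreg / ((F.P K).L : ℝ) ^ 2)) * (((F.P K).L : ℝ) ^ ((F.P K).d - 1)) ^ 2 ≤ 1)
    (hn2 : 13 * (2 * (((((F.P K).d + 2) * (F.P K).L : ℕ) : ℝ) * θ₀.ε₂₉) +
        ((((F.P K).d + 2) * (F.P K).L : ℕ) : ℝ) ^ 2 / 4 * (2 * θ₀.ν.εreg / ((F.P K).L : ℝ) ^ 2)) * ((F.P K).L : ℝ) ^ ((F.P K).d - 1) < deltaSU (Fin N))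
    (hord : 2 * θ₀.ν.εreg / ((F.P K).L : ℝ) ^ 2 +
      4 * max θ₀.ε₂₉ (10 * (((((F.P K).d + 2) * (F.P K).L : ℕ) : ℝ) * θ₀.ε₂₉) * ((F.P K).L : ℝ) ^ ((F.P K).d - 1)) ≤ θ₀.ν.ε₀)
    (hsolν : ∀ j < K, ∀ W ∈ domAltOfRecord F N θ₀.ν K (j + 1), UkExists F N K (j + 1) θ₀.ν.εreg W)
    (hα : ((((F.P K).d + 2) * (F.P K).L : ℕ) : ℝ) ^ 2 / 4 * θ₀.ν.ε₀ < α)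
    (hcrit : ContinuousOn (critCfgOfRecord F N θ₀.ν K j) (domAltOfRecord F N θ₀.ν K (j + 1)))
    [DecidablePred (· ∈ {p : ((PBond (F.P K) (j + 1) → SU N) × GaugeField (F.P K) j (SU N)) |
          ({q : ((PBond (F.P K) (j + 1) → SU N) × GaugeField (F.P K) j (SU N)) | ∀ c, q.1 c ∈ T c q.2}.indicator fun q => ∏ c, jd c q.2 (q.1 c)) p ≠ 0 ∧
            (extend centralBond (fun c => ϑ c p.2 (p.1 c)) p.2 : GaugeField (F.P K) j (SU N)) ∈
              {U : GaugeField (F.P K) j (SU N) | chiFixed29 F N θ₀.ν θ₀.ε₂₉ K g j U ≠ 0}})] :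
    ∀ V₀ ∈ domAltOfRecord F N θ₀.ν K (j + 1), ∀ᵐ z ∂(fieldMeasure (F.P K) j (SU N)),
      ContinuousWithinAt (fun V => (Set.piecewise {p : ((PBond (F.P K) (j + 1) → SU N) × GaugeField (F.P K) j (SU N)) |
          ({q : ((PBond (F.P K) (j + 1) → SU N) × GaugeField (F.P K) j (SU N)) | ∀ c, q.1 c ∈ T c q.2}.indicator fun q => ∏ c, jd c q.2 (q.1 c)) p ≠ 0 ∧
            (extend centralBond (fun c => ϑ c p.2 (p.1 c)) p.2 : GaugeField (F.P K) j (SU N)) ∈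
              {U : GaugeField (F.P K) j (SU N) | chiFixed29 F N θ₀.ν θ₀.ε₂₉ K g j U ≠ 0}}
        (fun p => (extend centralBond (fun c => ϑ c p.2 (p.1 c)) p.2 : GaugeField (F.P K) j (SU N)))
        (fun p => critCfgOfRecord F N θ₀.ν K j p.1)) (V, z)) (domAltOfRecord F N θ₀.ν K (j + 1)) V₀ := by
  intro V₀ hV₀
  filter_upwards [ae_not_threshold θ₀ T ϑ hj hT hleft hε29 V₀] with z hz
  exact (continuousWithinAt_towerChart_of_not_threshold θ₀ g T ϑ jd hj hαδ hT hleft hopen hjc hjd0 hεreg hε3 hε2 hε29.le hn1 hn2 hord hsolν hα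
    hcrit hV₀ hz).1

/-- ★★★ **THE TOWER'S SOCKET `hJV` AT LEVEL `j < K`** — the SHAPE of `hreg_pos_all_of_perBondCharts_centralWindow`'s binder `hJV j hj` VERBATIM: for every `V₀ ∈ domAlt_{j+1}`,
for a.e. fine field `z`, the re-based Jacobian `V ↦ (J′(V, z) : ℝ)` is continuous within `domAlt_{j+1}` at `V₀`.  Same displayed hypotheses; the exceptional set is dag-n09-w3 g5's.
Nothing of Bałaban's asserted. [cite: Balaban1987RG1, (0.4) p.253, p.259, (2.3) p.265, (2.9)–(2.10) pp.266–267; Balaban1985Averaging, (19) p.21 and Prop. 2 (53) p.26] -/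
theorem tower_hJV_of_windowOpenness_of_hsolν_of_numerics (hj : j < K) (hαδ : α < deltaSU (Fin N))
    (hT : ∀ c U, T c U = (fun g => (avOfRecord F N K j).avg (update U (centralBond c) g) c) ''
        {g : SU N | ∀ i : Idx (F.P K), dist1 (fibreFamily U c (pre U c * g * post U c) i) ≤ α})
    (hleft : ∀ c U g, (∀ i : Idx (F.P K), dist1 (fibreFamily U c (pre U c * g * post U c) i) ≤ α) →
        ϑ c U ((avOfRecord F N K j).avg (update U (centralBond c) g) c) = g)
    (hopen : ∀ (c : PBond (F.P K) (j + 1)) (U : GaugeField (F.P K) j (SU N)) (g : SU N),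
      (∀ i : Idx (F.P K), dist1 (fibreFamily U c (pre U c * g * post U c) i) < α) →
        (fun g' => (avOfRecord F N K j).avg (update U (centralBond c) g') c) ''
            {g' : SU N | ∀ i : Idx (F.P K), dist1 (fibreFamily U c (pre U c * g' * post U c) i) ≤ α} ∈
          𝓝 ((avOfRecord F N K j).avg (update U (centralBond c) g) c))
    (hjc : ∀ c U, ContinuousOn (jd c U) (T c U)) (hjd0 : ∀ c U v, v ∈ T c U → jd c U v ≠ 0)
    (hεreg : 0 < θ₀.ν.εreg) (hε3 : (143 * (((((F.P K).d + 4 : ℕ) : ℝ)) ^ 2 / 4) ^ 2) * θ₀.ν.εreg ≤ 1 / 3)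
    (hε2 : 2 * θ₀.ν.εreg ≤ 2 * deltaSU (Fin N) / ((((F.P K).d + 4) * (F.P K).L : ℕ) : ℝ) ^ 2) (hε29 : 0 < θ₀.ε₂₉)
    (hn1 : 1640 * (2 * (((((F.P K).d + 2) * (F.P K).L : ℕ) : ℝ) * θ₀.ε₂₉) +
        ((((F.P K).d + 2) * (F.P K).L : ℕ) : ℝ) ^ 2 / 4 * (2 * θ₀.ν.εreg / ((F.P K).L : ℝ) ^ 2)) * (((F.P K).L : ℝ) ^ ((F.P K).d - 1)) ^ 2 ≤ 1)
    (hn2 : 13 * (2 * (((((F.P K).d + 2) * (F.P K).L : ℕ) : ℝ) * θ₀.ε₂₉) +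
        ((((F.P K).d + 2) * (F.P K).L : ℕ) : ℝ) ^ 2 / 4 * (2 * θ₀.ν.εreg / ((F.P K).L : ℝ) ^ 2)) * ((F.P K).L : ℝ) ^ ((F.P K).d - 1) < deltaSU (Fin N))
    (hord : 2 * θ₀.ν.εreg / ((F.P K).L : ℝ) ^ 2 +
      4 * max θ₀.ε₂₉ (10 * (((((F.P K).d + 2) * (F.P K).L : ℕ) : ℝ) * θ₀.ε₂₉) * ((F.P K).L : ℝ) ^ ((F.P K).d - 1)) ≤ θ₀.ν.ε₀)
    (hsolν : ∀ j < K, ∀ W ∈ domAltOfRecord F N θ₀.ν K (j + 1), UkExists F N K (j + 1) θ₀.ν.εreg W)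
    (hα : ((((F.P K).d + 2) * (F.P K).L : ℕ) : ℝ) ^ 2 / 4 * θ₀.ν.ε₀ < α)
    (hcrit : ContinuousOn (critCfgOfRecord F N θ₀.ν K j) (domAltOfRecord F N θ₀.ν K (j + 1)))
    [DecidablePred (· ∈ {p : ((PBond (F.P K) (j + 1) → SU N) × GaugeField (F.P K) j (SU N)) |
          ({q : ((PBond (F.P K) (j + 1) → SU N) × GaugeField (F.P K) j (SU N)) | ∀ c, q.1 c ∈ T c q.2}.indicator fun q => ∏ c, jd c q.2 (q.1 c)) p ≠ 0 ∧
            (extend centralBond (fun c => ϑ c p.2 (p.1 c)) p.2 : GaugeField (F.P K) j (SU N)) ∈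
              {U : GaugeField (F.P K) j (SU N) | chiFixed29 F N θ₀.ν θ₀.ε₂₉ K g j U ≠ 0}})] :
    ∀ V₀ ∈ domAltOfRecord F N θ₀.ν K (j + 1), ∀ᵐ z ∂(fieldMeasure (F.P K) j (SU N)),
      ContinuousWithinAt (fun V => (((Set.indicator {p : ((PBond (F.P K) (j + 1) → SU N) × GaugeField (F.P K) j (SU N)) |
          ({q : ((PBond (F.P K) (j + 1) → SU N) × GaugeField (F.P K) j (SU N)) | ∀ c, q.1 c ∈ T c q.2}.indicator fun q => ∏ c, jd c q.2 (q.1 c)) p ≠ 0 ∧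
            (extend centralBond (fun c => ϑ c p.2 (p.1 c)) p.2 : GaugeField (F.P K) j (SU N)) ∈
              {U : GaugeField (F.P K) j (SU N) | chiFixed29 F N θ₀.ν θ₀.ε₂₉ K g j U ≠ 0}}
        ({q : ((PBond (F.P K) (j + 1) → SU N) × GaugeField (F.P K) j (SU N)) | ∀ c, q.1 c ∈ T c q.2}.indicator fun q => ∏ c, jd c q.2 (q.1 c))) (V, z) : ℝ≥0) : ℝ))
        (domAltOfRecord F N θ₀.ν K (j + 1)) V₀ := by
  intro V₀ hV₀
  filter_upwards [ae_not_threshold θ₀ T ϑ hj hT hleft hε29 V₀] with z hz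
  exact (continuousWithinAt_towerChart_of_not_threshold θ₀ g T ϑ jd hj hαδ hT hleft hopen hjc hjd0 hεreg hε3 hε2 hε29.le hn1 hn2 hord hsolν hα
    hcrit hV₀ hz).2

end Sockets

end Summit.QuantumFields.YangMills.BalabanUVNodes.N09TowerAESocketsOfWindowOpenness

end
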